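import Mathlib
import HarnessLib
import Literature.MathematicalPhysics.KineticTheory.FouriersLaw
import Literature.MathematicalPhysics.KineticTheory.LangevinChainSDE
import Literature.MathematicalPhysics.KineticTheory.LangevinChainNESSProofs

/-!
# Stub A (`stub_algebraize`) of line `birth` of the crux `HiddenChargeMazur.DressedCharge`
(item stmt-AtomisticToContinuum-13509)

The item's ANALYTIC clauses for the pinned anharmonic chain `pinnedChain ω₂ lam β γ` (polynomial
window density `g` of range `R`, polynomial flux `ψ`, momentum-odd `g`, and the local conservation
law written with `deriv`, `Function.update` and a `tsum` over sites) are converted into ALGEBRA in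
the lattice polynomial ring `MvPolynomial (ℤ ⊕ ℤ) ℝ` (`X (inl x) = q_x`, `X (inr x) = p_x`):
`G := rename (i ↦ i − R) p_g` has its variables at the sites `[-R, R]` and `g (σ(· − R)) = eval_σ G`;
`Θ G = −G` for the momentum reversal `Θ = aeval (q ↦ q, p ↦ −p)`; and `L G = Ψ − τΨ` with
`Ψ := rename (i ↦ i − (R+1)) p_ψ`, the Liouville DERIVATION `L = mkDerivation ℝ (q_x ↦ p_x, p_x ↦ F_x)`
and the shift `τ = rename (+1)`.  Tools: one-variable polynomial calculus (`deriv_eval_update`),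
the `tsum` is the finite window sum, `mkDerivation` is a finite combination of partial derivatives
(`mkDerivation_apply_eq_sum_sites`), and `MvPolynomial.funext` (ℝ is infinite).
-/

noncomputable section

open Literature.MathematicalPhysics.KineticTheory.HeatConduction

namespace Summit.AtomisticToContinuum.FouriersLaw.Theorems.DressedCharge

/-! ## Polynomial calculus -/

/-- One-variable polynomial calculus: `t ↦ p(f with v := t)` has derivative
`(∂_v p)(f with v := t₀)` at `t₀`. -/
theorem hasDerivAt_eval_update {ι : Type*} [DecidableEq ι] (p : MvPolynomial ι ℝ) (f : ι → ℝ)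
    (v : ι) (t₀ : ℝ) :
    HasDerivAt (fun t => MvPolynomial.eval (Function.update f v t) p)
      (MvPolynomial.eval (Function.update f v t₀) (MvPolynomial.pderiv v p)) t₀ := by
  induction p using MvPolynomial.induction_on with
  | C a => simpa [MvPolynomial.pderiv_C] using hasDerivAt_const t₀ a
  | add p q hp hq =>
    simp only [map_add]
    exact hp.add hq
  | mul_X p i hp =>
    simp only [map_mul, MvPolynomial.eval_X, MvPolynomial.pderiv_mul, MvPolynomial.pderiv_X,
      map_add]
    by_cases hi : i = v
    · subst hi
      simp only [Pi.single_eq_same, map_one, mul_one, Function.update_self]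
      have e := hp.mul (hasDerivAt_id t₀)
      rw [mul_one] at e
      exact e
    · simp only [Pi.single_eq_of_ne hi, map_zero, mul_zero, add_zero]
      simpa [Function.update_of_ne hi] using hp.mul_const (f i)

/-- `d/dt|_{t = f v} p(f with v := t) = (∂_v p)(f)`. -/
theorem deriv_eval_update {ι : Type*} [DecidableEq ι] (p : MvPolynomial ι ℝ) (f : ι → ℝ) (v : ι) :
    deriv (fun t => MvPolynomial.eval (Function.update f v t) p) (f v) =
      MvPolynomial.eval f (MvPolynomial.pderiv v p) := by
  rw [(hasDerivAt_eval_update p f v (f v)).deriv, Function.update_eq_self]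

/-- Evaluating a substitution instance: `(aeval h p)(f) = p(v ↦ (h v)(f))`. -/
theorem eval_aeval_eq_eval {ι τ R : Type*} [CommRing R] (f : τ → R) (h : ι → MvPolynomial τ R)
    (p : MvPolynomial ι R) :
    MvPolynomial.eval f (MvPolynomial.aeval h p) =
      MvPolynomial.eval (fun v => MvPolynomial.eval f (h v)) p := by
  induction p using MvPolynomial.induction_on with
  | C a => simp
  | add p q hp hq => simp only [map_add, hp, hq]
  | mul_X p i hp => simp only [map_mul, MvPolynomial.aeval_X, MvPolynomial.eval_X, hp]

/-- An explicit derivation is a finite combination of partial derivatives: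
`mkDerivation R h p = ∑_{v ∈ S} h v · ∂_v p` for every finset `S ⊇ vars p`. -/
theorem mkDerivation_apply_eq_sum {ι R : Type*} [CommRing R] (h : ι → MvPolynomial ι R)
    (p : MvPolynomial ι R) {S : Finset ι} (hS : p.vars ⊆ S) :
    MvPolynomial.mkDerivation R h p = ∑ v ∈ S, h v * MvPolynomial.pderiv v p := by
  classical
  let D : Derivation R (MvPolynomial ι R) (MvPolynomial ι R) :=
    ∑ v ∈ S, h v • (MvPolynomial.pderiv v : Derivation R (MvPolynomial ι R) (MvPolynomial ι R))
  have hD : ∀ q : MvPolynomial ι R, D q = ∑ v ∈ S, h v * MvPolynomial.pderiv v q := by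
    intro q
    show Derivation.coeFnAddMonoidHom D q = _
    simp only [D, map_sum, Finset.sum_apply]
    refine Finset.sum_congr rfl fun v _ => ?_
    rfl
  rw [← hD]
  refine MvPolynomial.derivation_eq_of_forall_mem_vars fun i hi => ?_
  rw [MvPolynomial.mkDerivation_X, hD, Finset.sum_eq_single i]
  · simp
  · intro b _ hb
    rw [MvPolynomial.pderiv_X_of_ne (Ne.symm hb), mul_zero]
  · intro hi'
    exact absurd (hS hi) hi'

/-- Two-sorted version on `MvPolynomial (α ⊕ α) R` (positions `inl`, momenta `inr`): if every
variable of `p` sits at a site of `T`, then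
`mkDerivation R h p = ∑_{x ∈ T} (h (inl x) ∂_{inl x} p + h (inr x) ∂_{inr x} p)`. -/
theorem mkDerivation_apply_eq_sum_sites {α R : Type*} [CommRing R]
    (h : α ⊕ α → MvPolynomial (α ⊕ α) R) (p : MvPolynomial (α ⊕ α) R) {T : Finset α}
    (hT : ∀ v ∈ p.vars, Sum.elim id id v ∈ T) :
    MvPolynomial.mkDerivation R h p =
      ∑ x ∈ T, (h (Sum.inl x) * MvPolynomial.pderiv (Sum.inl x) p +
        h (Sum.inr x) * MvPolynomial.pderiv (Sum.inr x) p) := by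
  classical
  have hS : p.vars ⊆ T.image Sum.inl ∪ T.image Sum.inr := by
    intro v hv
    have hv' := hT v hv
    rcases v with x | x
    · exact Finset.mem_union_left _ (Finset.mem_image_of_mem _ hv')
    · exact Finset.mem_union_right _ (Finset.mem_image_of_mem _ hv')
  rw [mkDerivation_apply_eq_sum h p hS, Finset.sum_union, Finset.sum_image, Finset.sum_image,
    ← Finset.sum_add_distrib]
  · intro x _ y _ hxy
    exact Sum.inr_injective hxy
  · intro x _ y _ hxy
    exact Sum.inl_injective hxy
  · rw [Finset.disjoint_left]
    intro v hv hv'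
    rw [Finset.mem_image] at hv hv'
    obtain ⟨x, _, rfl⟩ := hv
    obtain ⟨y, _, hy⟩ := hv'
    cases hy

/-! ## The window density as a lattice polynomial -/

/-- Evaluating the re-indexed window polynomial at (the flat coordinates of) a configuration =
evaluating the window polynomial at the window `σ(· − R)`. -/
theorem eval_rename_window (R : ℕ) (p : MvPolynomial (Fin (2 * R + 1) ⊕ Fin (2 * R + 1)) ℝ)
    (σ : ℤ → ℝ × ℝ) :
    MvPolynomial.eval (Sum.elim (fun x : ℤ => (σ x).1) (fun x : ℤ => (σ x).2))
      (MvPolynomial.rename (Sum.map (fun i : Fin (2 * R + 1) => (i : ℤ) - (R : ℕ))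
        (fun i : Fin (2 * R + 1) => (i : ℤ) - (R : ℕ))) p) =
      MvPolynomial.eval (Sum.elim (fun i : Fin (2 * R + 1) => (σ ((i : ℤ) - (R : ℕ))).1)
        (fun i : Fin (2 * R + 1) => (σ ((i : ℤ) - (R : ℕ))).2)) p := by
  rw [MvPolynomial.eval_rename]
  have h : Sum.elim (fun x : ℤ => (σ x).1) (fun x : ℤ => (σ x).2) ∘
      Sum.map (fun i : Fin (2 * R + 1) => (i : ℤ) - (R : ℕ)) (fun i : Fin (2 * R + 1) => (i : ℤ) - (R : ℕ)) =
      Sum.elim (fun i : Fin (2 * R + 1) => (σ ((i : ℤ) - (R : ℕ))).1)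
        (fun i : Fin (2 * R + 1) => (σ ((i : ℤ) - (R : ℕ))).2) := by
    funext v
    cases v <;> rfl
  rw [h]

/-- The variables of the re-indexed window polynomial sit at the sites `[-R, R]`. -/
theorem vars_rename_window (R : ℕ) (p : MvPolynomial (Fin (2 * R + 1) ⊕ Fin (2 * R + 1)) ℝ) :
    ∀ v ∈ (MvPolynomial.rename (Sum.map (fun i : Fin (2 * R + 1) => (i : ℤ) - (R : ℕ))
      (fun i : Fin (2 * R + 1) => (i : ℤ) - (R : ℕ))) p).vars,
      Sum.elim id id v ∈ Finset.Icc (-(R : ℤ)) R := by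
  classical
  intro v hv
  obtain ⟨w, -, rfl⟩ := Finset.mem_image.1 (MvPolynomial.vars_rename _ _ hv)
  rcases w with i | i
  · have hi : (i : ℕ) < 2 * R + 1 := i.isLt
    simp only [Sum.map_inl, Sum.elim_inl, id, Finset.mem_Icc]
    omega
  · have hi : (i : ℕ) < 2 * R + 1 := i.isLt
    simp only [Sum.map_inr, Sum.elim_inr, id, Finset.mem_Icc]
    omega

section Window

variable {R : ℕ} {g : (Fin (2 * R + 1) → ℝ × ℝ) → ℝ} {G : MvPolynomial (ℤ ⊕ ℤ) ℝ}

/-- The position / momentum derivatives at site `x` of the window density are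
`(∂_{q_x} G)(σ)` / `(∂_{p_x} G)(σ)`. -/
theorem deriv_window
    (hG : ∀ σ : ℤ → ℝ × ℝ, g (fun i : Fin (2 * R + 1) => σ ((i : ℤ) - (R : ℕ))) =
      MvPolynomial.eval (Sum.elim (fun x : ℤ => (σ x).1) (fun x : ℤ => (σ x).2)) G)
    (σ : ℤ → ℝ × ℝ) (x : ℤ) :
    deriv (fun t => g (fun i : Fin (2 * R + 1) =>
        Function.update σ x (t, (σ x).2) ((i : ℤ) - (R : ℕ)))) (σ x).1 =
      MvPolynomial.eval (Sum.elim (fun x : ℤ => (σ x).1) (fun x : ℤ => (σ x).2))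
        (MvPolynomial.pderiv (Sum.inl x) G) ∧
    deriv (fun t => g (fun i : Fin (2 * R + 1) =>
        Function.update σ x ((σ x).1, t) ((i : ℤ) - (R : ℕ)))) (σ x).2 =
      MvPolynomial.eval (Sum.elim (fun x : ℤ => (σ x).1) (fun x : ℤ => (σ x).2))
        (MvPolynomial.pderiv (Sum.inr x) G) := by
  have h1 : (fun t => g (fun i : Fin (2 * R + 1) =>
      Function.update σ x (t, (σ x).2) ((i : ℤ) - (R : ℕ)))) = fun t => MvPolynomial.eval
        (Function.update (Sum.elim (fun x : ℤ => (σ x).1) (fun x : ℤ => (σ x).2)) (Sum.inl x) t) G := by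
    funext t
    rw [hG (Function.update σ x (t, (σ x).2))]
    refine congrArg (fun F : ℤ ⊕ ℤ → ℝ => MvPolynomial.eval F G) (funext fun v => ?_)
    rcases v with y | y <;> by_cases hy : y = x
    · subst hy; simp
    · simp [Function.update_apply, hy]
    · subst hy; simp
    · simp [Function.update_apply, hy]
  have h2 : (fun t => g (fun i : Fin (2 * R + 1) =>
      Function.update σ x ((σ x).1, t) ((i : ℤ) - (R : ℕ)))) = fun t => MvPolynomial.eval
        (Function.update (Sum.elim (fun x : ℤ => (σ x).1) (fun x : ℤ => (σ x).2)) (Sum.inr x) t) G := by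
    funext t
    rw [hG (Function.update σ x ((σ x).1, t))]
    refine congrArg (fun F : ℤ ⊕ ℤ → ℝ => MvPolynomial.eval F G) (funext fun v => ?_)
    rcases v with y | y <;> by_cases hy : y = x
    · subst hy; simp
    · simp [Function.update_apply, hy]
    · subst hy; simp
    · simp [Function.update_apply, hy]
  rw [h1, h2]
  exact ⟨deriv_eval_update G _ (Sum.inl x), deriv_eval_update G _ (Sum.inr x)⟩

/-- **Transfer of the conservation law.** If `G` carries the window density `g` (variables in
`[-R, R]`), the generator assignment `h` evaluates to the velocity `p_x` on `inl x` and to the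
force `−U'(q_x) + V'(q_{x+1} − q_x) − V'(q_x − q_{x−1})` of `P` on `inr x`, and `Ψ`, `τΨ` evaluate
to the two flux terms, then the analytic local conservation law `∑' x, … = ψ − ψ∘shift` is the
identity `mkDerivation ℝ h G = Ψ − τΨ` of lattice polynomials. -/
theorem law_transfer {P : OscillatorChain} {h : ℤ ⊕ ℤ → MvPolynomial (ℤ ⊕ ℤ) ℝ}
    {Ψ : MvPolynomial (ℤ ⊕ ℤ) ℝ} {ψ : (Fin (2 * (R + 1) + 1) → ℝ × ℝ) → ℝ}
    (hG : ∀ σ : ℤ → ℝ × ℝ, g (fun i : Fin (2 * R + 1) => σ ((i : ℤ) - (R : ℕ))) =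
      MvPolynomial.eval (Sum.elim (fun x : ℤ => (σ x).1) (fun x : ℤ => (σ x).2)) G)
    (hvars : ∀ v ∈ G.vars, Sum.elim id id v ∈ Finset.Icc (-(R : ℤ)) R)
    (hh₁ : ∀ (σ : ℤ → ℝ × ℝ) (x : ℤ),
      MvPolynomial.eval (Sum.elim (fun x : ℤ => (σ x).1) (fun x : ℤ => (σ x).2)) (h (Sum.inl x)) = (σ x).2)
    (hh₂ : ∀ (σ : ℤ → ℝ × ℝ) (x : ℤ),
      MvPolynomial.eval (Sum.elim (fun x : ℤ => (σ x).1) (fun x : ℤ => (σ x).2)) (h (Sum.inr x)) =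
        -deriv P.U (σ x).1 + (deriv P.V ((σ (x + 1)).1 - (σ x).1) - deriv P.V ((σ x).1 - (σ (x - 1)).1)))
    (hΨ : ∀ σ : ℤ → ℝ × ℝ,
      MvPolynomial.eval (Sum.elim (fun x : ℤ => (σ x).1) (fun x : ℤ => (σ x).2)) Ψ =
        ψ (fun i : Fin (2 * (R + 1) + 1) => σ ((i : ℤ) - (R + 1 : ℕ))))
    (hτΨ : ∀ σ : ℤ → ℝ × ℝ,
      MvPolynomial.eval (Sum.elim (fun x : ℤ => (σ x).1) (fun x : ℤ => (σ x).2))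
        (MvPolynomial.rename (Sum.map (fun i : ℤ => i + 1) (fun i : ℤ => i + 1)) Ψ) =
        ψ (fun i : Fin (2 * (R + 1) + 1) => σ ((i : ℤ) - (R + 1 : ℕ) + 1)))
    (hlaw : ∀ σ : ℤ → ℝ × ℝ, (∑' x : ℤ, ((σ x).2 * deriv (fun t => g (fun i : Fin (2 * R + 1) =>
      Function.update σ x (t, (σ x).2) ((i : ℤ) - (R : ℕ)))) (σ x).1 + (-deriv P.U (σ x).1 +
      (deriv P.V ((σ (x + 1)).1 - (σ x).1) - deriv P.V ((σ x).1 - (σ (x - 1)).1))) *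
      deriv (fun t => g (fun i : Fin (2 * R + 1) => Function.update σ x ((σ x).1, t) ((i : ℤ) - (R : ℕ))))
      (σ x).2)) = ψ (fun i : Fin (2 * (R + 1) + 1) => σ ((i : ℤ) - (R + 1 : ℕ))) -
      ψ (fun i : Fin (2 * (R + 1) + 1) => σ ((i : ℤ) - (R + 1 : ℕ) + 1))) :
    MvPolynomial.mkDerivation ℝ h G =
      Ψ - MvPolynomial.rename (Sum.map (fun i : ℤ => i + 1) (fun i : ℤ => i + 1)) Ψ := by
  classical
  -- the window form of the law, for every configuration
  have hfin : ∀ σ : ℤ → ℝ × ℝ, ∑ x ∈ Finset.Icc (-(R : ℤ)) R,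
      MvPolynomial.eval (Sum.elim (fun x : ℤ => (σ x).1) (fun x : ℤ => (σ x).2))
        (h (Sum.inl x) * MvPolynomial.pderiv (Sum.inl x) G + h (Sum.inr x) * MvPolynomial.pderiv (Sum.inr x) G) =
      MvPolynomial.eval (Sum.elim (fun x : ℤ => (σ x).1) (fun x : ℤ => (σ x).2)) Ψ -
        MvPolynomial.eval (Sum.elim (fun x : ℤ => (σ x).1) (fun x : ℤ => (σ x).2))
          (MvPolynomial.rename (Sum.map (fun i : ℤ => i + 1) (fun i : ℤ => i + 1)) Ψ) := by
    intro σ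
    rw [hΨ, hτΨ, ← hlaw σ, tsum_eq_sum (s := Finset.Icc (-(R : ℤ)) R)]
    · refine Finset.sum_congr rfl fun x _ => ?_
      rw [map_add, map_mul, map_mul, hh₁, hh₂, (deriv_window hG σ x).1, (deriv_window hG σ x).2]
    · intro x hx
      rw [(deriv_window hG σ x).1, (deriv_window hG σ x).2,
        MvPolynomial.pderiv_eq_zero_of_notMem_vars (i := Sum.inl x) (f := G) fun h => hx (hvars _ h),
        MvPolynomial.pderiv_eq_zero_of_notMem_vars (i := Sum.inr x) (f := G) fun h => hx (hvars _ h)]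
      simp
  apply MvPolynomial.funext
  intro f
  rw [mkDerivation_apply_eq_sum_sites _ _ hvars, map_sum, map_sub]
  have e := hfin (fun x => (f (Sum.inl x), f (Sum.inr x)))
  have hf : (Sum.elim (fun x : ℤ => ((fun x => (f (Sum.inl x), f (Sum.inr x))) x).1)
      (fun x : ℤ => ((fun x => (f (Sum.inl x), f (Sum.inr x))) x).2) : ℤ ⊕ ℤ → ℝ) = f := by
    funext v
    cases v <;> rfl
  rw [hf] at e
  exact e

/-- **Transfer of momentum-oddness**: if `G` carries the window density `g` and `g` is odd under
`p ↦ −p`, then `Θ G = −G` for `Θ = aeval (q ↦ q, p ↦ −p)`. -/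
theorem odd_transfer
    (hG : ∀ σ : ℤ → ℝ × ℝ, g (fun i : Fin (2 * R + 1) => σ ((i : ℤ) - (R : ℕ))) =
      MvPolynomial.eval (Sum.elim (fun x : ℤ => (σ x).1) (fun x : ℤ => (σ x).2)) G)
    (hodd : ∀ y : Fin (2 * R + 1) → ℝ × ℝ, g (fun i => ((y i).1, -(y i).2)) = -g y) :
    MvPolynomial.aeval (Sum.elim (fun i : ℤ => (MvPolynomial.X (Sum.inl i) : MvPolynomial (ℤ ⊕ ℤ) ℝ))
      (fun i : ℤ => -MvPolynomial.X (Sum.inr i))) G = -G := by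
  apply MvPolynomial.funext
  intro f
  rw [eval_aeval_eq_eval, map_neg]
  have h1 : (fun v => MvPolynomial.eval f (Sum.elim
      (fun i : ℤ => (MvPolynomial.X (Sum.inl i) : MvPolynomial (ℤ ⊕ ℤ) ℝ))
      (fun i : ℤ => -MvPolynomial.X (Sum.inr i)) v)) =
      Sum.elim (fun x : ℤ => ((fun x => (f (Sum.inl x), -f (Sum.inr x))) x).1)
        (fun x : ℤ => ((fun x => (f (Sum.inl x), -f (Sum.inr x))) x).2) := by
    funext v
    cases v <;> simp
  have hf : (Sum.elim (fun x : ℤ => ((fun x => (f (Sum.inl x), f (Sum.inr x))) x).1)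
      (fun x : ℤ => ((fun x => (f (Sum.inl x), f (Sum.inr x))) x).2) : ℤ ⊕ ℤ → ℝ) = f := by
    funext v
    cases v <;> rfl
  have e1 := hG (fun x => (f (Sum.inl x), -f (Sum.inr x)))
  have e2 := hG (fun x => (f (Sum.inl x), f (Sum.inr x)))
  have e3 := hodd (fun i => (f (Sum.inl ((i : ℤ) - (R : ℕ))), f (Sum.inr ((i : ℤ) - (R : ℕ)))))
  rw [hf] at e2
  rw [h1, ← e1, ← e2]
  exact e3

end Window

/-! ## The stub -/

/-- **Stub A (`stub_algebraize`)**: the analytic clauses of the route statement for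
`P = pinnedChain ω₂ lam β γ` (polynomial window density `g`, polynomial flux `ψ`, momentum-odd
`g`, local conservation law `∀ σ, ∑' x, (p_x ∂_{q_x} + F_x ∂_{p_x})(g ∘ window) = ψ ∘ box − ψ ∘ box ∘ shift`)
yield lattice polynomials `G Ψ : MvPolynomial (ℤ ⊕ ℤ) ℝ` with: the variables of `G` in the
window `[-R, R]`, `g (σ(· − R)) = eval_σ G`, oddness `Θ G = −G`, and the algebraic conservation
law `L G = Ψ − τΨ` for the Liouville derivation `L = mkDerivation ℝ (q_x ↦ p_x, p_x ↦ F_x)`. -/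
theorem stub_algebraize :
    ∀ ω₂ lam β γ : ℝ, ∀ P : OscillatorChain, P = pinnedChain ω₂ lam β γ →
    ∀ (R : ℕ) (g : (Fin (2 * R + 1) → ℝ × ℝ) → ℝ) (ψ : (Fin (2 * (R + 1) + 1) → ℝ × ℝ) → ℝ),
      (∃ p : MvPolynomial (Fin (2 * R + 1) ⊕ Fin (2 * R + 1)) ℝ, ∀ y : Fin (2 * R + 1) → ℝ × ℝ, g y = MvPolynomial.eval (Sum.elim (fun i => (y i).1) (fun i => (y i).2)) p) →
      (∃ p : MvPolynomial (Fin (2 * (R + 1) + 1) ⊕ Fin (2 * (R + 1) + 1)) ℝ, ∀ y : Fin (2 * (R + 1) + 1) → ℝ × ℝ, ψ y = MvPolynomial.eval (Sum.elim (fun i => (y i).1) (fun i => (y i).2)) p) →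
      (∀ y : Fin (2 * R + 1) → ℝ × ℝ, g (fun i => ((y i).1, -(y i).2)) = -g y) →
      (∀ σ : ℤ → ℝ × ℝ, (∑' x : ℤ, ((σ x).2 * deriv (fun t => g (fun i : Fin (2 * R + 1) => Function.update σ x (t, (σ x).2) ((i : ℤ) - (R : ℕ)))) (σ x).1 + (-deriv P.U (σ x).1 + (deriv P.V ((σ (x + 1)).1 - (σ x).1) - deriv P.V ((σ x).1 - (σ (x - 1)).1))) * deriv (fun t => g (fun i : Fin (2 * R + 1) => Function.update σ x ((σ x).1, t) ((i : ℤ) - (R : ℕ)))) (σ x).2)) = ψ (fun i : Fin (2 * (R + 1) + 1) => σ ((i : ℤ) - (R + 1 : ℕ))) - ψ (fun i : Fin (2 * (R + 1) + 1) => σ ((i : ℤ) - (R + 1 : ℕ) + 1))) →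
      ∃ G Ψ : MvPolynomial (ℤ ⊕ ℤ) ℝ,
        (∀ v ∈ G.vars, Sum.elim id id v ∈ Set.Icc (-(R : ℤ)) R) ∧
        (∀ σ : ℤ → ℝ × ℝ, g (fun i : Fin (2 * R + 1) => σ ((i : ℤ) - (R : ℕ))) = MvPolynomial.eval (Sum.elim (fun x : ℤ => (σ x).1) (fun x : ℤ => (σ x).2)) G) ∧
        MvPolynomial.aeval (Sum.elim (fun i : ℤ => (MvPolynomial.X (Sum.inl i) : MvPolynomial (ℤ ⊕ ℤ) ℝ)) (fun i : ℤ => -MvPolynomial.X (Sum.inr i))) (G) = -G ∧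
        (MvPolynomial.mkDerivation ℝ (Sum.elim (fun i : ℤ => (MvPolynomial.X (Sum.inr i) : MvPolynomial (ℤ ⊕ ℤ) ℝ)) (fun i : ℤ => -(MvPolynomial.C ω₂ * MvPolynomial.X (Sum.inl i) + MvPolynomial.C lam * MvPolynomial.X (Sum.inl i) ^ 3) + ((MvPolynomial.X (Sum.inl (i + 1)) - MvPolynomial.X (Sum.inl i)) + MvPolynomial.C β * (MvPolynomial.X (Sum.inl (i + 1)) - MvPolynomial.X (Sum.inl i)) ^ 3) - ((MvPolynomial.X (Sum.inl i) - MvPolynomial.X (Sum.inl (i - 1))) + MvPolynomial.C β * (MvPolynomial.X (Sum.inl i) - MvPolynomial.X (Sum.inl (i - 1))) ^ 3)))) G = Ψ - MvPolynomial.rename (Sum.map (fun i : ℤ => i + 1) (fun i : ℤ => i + 1)) (Ψ) := by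
  intro ω₂ lam β γ P hP R g ψ hg hψ hodd hlaw
  obtain ⟨pg, hpg⟩ := hg
  obtain ⟨pψ, hpψ⟩ := hψ
  -- `G := rename (i ↦ i - R) pg` carries the window density
  have hGeval : ∀ σ : ℤ → ℝ × ℝ, g (fun i : Fin (2 * R + 1) => σ ((i : ℤ) - (R : ℕ))) =
      MvPolynomial.eval (Sum.elim (fun x : ℤ => (σ x).1) (fun x : ℤ => (σ x).2))
        (MvPolynomial.rename (Sum.map (fun i : Fin (2 * R + 1) => (i : ℤ) - (R : ℕ))
          (fun i : Fin (2 * R + 1) => (i : ℤ) - (R : ℕ))) pg) := by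
    intro σ
    rw [eval_rename_window]
    exact hpg _
  have hvars := vars_rename_window R pg
  refine ⟨MvPolynomial.rename (Sum.map (fun i : Fin (2 * R + 1) => (i : ℤ) - (R : ℕ))
      (fun i : Fin (2 * R + 1) => (i : ℤ) - (R : ℕ))) pg,
    MvPolynomial.rename (Sum.map (fun i : Fin (2 * (R + 1) + 1) => (i : ℤ) - (R + 1 : ℕ))
      (fun i : Fin (2 * (R + 1) + 1) => (i : ℤ) - (R + 1 : ℕ))) pψ,
    fun v hv => ?_, hGeval, odd_transfer hGeval hodd, ?_⟩
  · -- (1) variables in the window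
    have h := hvars v hv
    rw [Finset.mem_Icc] at h
    exact h
  · -- (4) the conservation law in the lattice polynomial ring
    refine law_transfer hGeval hvars (fun σ x => by simp) (fun σ x => ?_) (fun σ => ?_) (fun σ => ?_) hlaw
    · subst hP
      simp only [Sum.elim_inr, Sum.elim_inl, MvPolynomial.eval_X, MvPolynomial.eval_C, map_neg,
        map_add, map_sub, map_mul, map_pow, pinnedChain_deriv_U, pinnedChain_deriv_V]
      ring
    · rw [eval_rename_window]
      exact (hpψ _).symm
    · rw [MvPolynomial.rename_rename, MvPolynomial.eval_rename, hpψ]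
      have e : Sum.elim (fun x : ℤ => (σ x).1) (fun x : ℤ => (σ x).2) ∘
          Sum.map (fun i : ℤ => i + 1) (fun i : ℤ => i + 1) ∘
          Sum.map (fun i : Fin (2 * (R + 1) + 1) => (i : ℤ) - (R + 1 : ℕ))
            (fun i : Fin (2 * (R + 1) + 1) => (i : ℤ) - (R + 1 : ℕ)) =
          Sum.elim (fun i : Fin (2 * (R + 1) + 1) => (σ ((i : ℤ) - (R + 1 : ℕ) + 1)).1)
            (fun i : Fin (2 * (R + 1) + 1) => (σ ((i : ℤ) - (R + 1 : ℕ) + 1)).2) := by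
        funext v
        cases v <;> rfl
      rw [e]

end Summit.AtomisticToContinuum.FouriersLaw.Theorems.DressedCharge

end
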